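import Mathlib.Topology.Instances.AddCircle.Defs
import Literature.AlgebraicGeometry.Frobenioids.ArchimedeanUnitStabilizers
import Literature.AlgebraicGeometry.Frobenioids.ArchimedeanUnitCircle
import Literature.AlgebraicGeometry.Frobenioids.ArchimedeanIsotropy
import HarnessLib

/-!
# Frobenioids II, Theorem 3.6 (v) for `C = C^ℤ`: the clauses "trivial", "order two", "torsion",
# "torsion-free", "`≅ S¹ ⊗ ℚ`" — PROVED over any base `π : D → D₀`

Mochizuki, *The geometry of Frobenioids II: poly-Frobenioids*, Kyushu J. Math. **62** (2008)
401–460, §3, Theorem 3.6 (v), author's kurims text p. 37 [cite: MochizukiFrdII2008, Thm 3.6 (v) p.37]: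
"(v) Let `A ∈ Ob(F)`. Then the group `O^×(A)` is trivial if and only if one of the following holds:
(a) `Λ = ℤ` and `A` is complex non-isotropic; (b) `Λ = ℚ` and `A` is real; (c) `Λ = ℝ`. The group
`O^×(A)` is of order two if and only if `Λ = ℤ` and `A` is real. The group `O^×(A)` has infinitely
many torsion elements [and is in fact isomorphic to `S¹`] if and only if `Λ = ℤ` and `A` is complex
isotropic. The group `O^×(A)` is nontrivial and torsion-free [and in fact isomorphic to `S¹ ⊗ ℚ`] if
and only if `Λ = ℚ` and `A` is complex."

PROOF-ONLY companion (abc-iut cell, layer L1, seat abc-iut-L6-d7; PIECE 1 (b) of abc-iut-L1-t9's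
PIECES 2026-08-25T21:10:12Z / abc-iut-L1-lead (gen 2) 21:10:34Z): the five `Λ = ℤ` instances
`Thm36v_trivial`, `Thm36v_orderTwo`, `Thm36v_torsion`, `Thm36v_torsionFree`,
`Thm36v_isoCircleTensorRat` of abc-iut-L1-t9's schemas (`ArchimedeanBasicProperties.lean`) at
`G := π ⋙ D0.toArchBase`, `F := C.toElem π`, `Λ := .Z`, EXACTLY as typed there (the statements stay
t9's; the sixth clause `Thm36v_isoCircle` is t9's `thm36v_isoCircle_C`, `ArchimedeanUnitCircle.lean`).
Inputs: `ArchimedeanUnitStabilizers.lean` (units of non-isotropic objects are trivial; the involution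
`((id, 1, -1), id)`), abc-iut-L1-t9's `circleEquivUnits` (`O^×(X) ≅ S¹` for complex naively isotropic
`X`), abc-iut-L1-t6's `Ex33ii_isotropic_iff_holds` (isotropic ⟺ naively isotropic, Ex. 3.3 (ii)).
Case analysis behind the five clauses at `Λ = ℤ`: `X` real ⇒ `O^×(X) = {±1}` (`card_unitsSubgroup_of_isReal`);
`X` complex isotropic ⇒ `O^×(X) ≅ S¹` has infinitely many torsion elements
(`torsion_infinite_of_isComplex`, roots of unity via `AddCircle.addOrderOf_period_div`); `X` complex
non-isotropic ⇒ `O^×(X) = {1}`. No new notion; nothing printed is strengthened; nothing here bears on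
[IUTchIII] Cor 3.12.
-/

namespace Literature.AlgebraicGeometry.Frobenioids

open CategoryTheory Set Topology
open scoped Pointwise

universe v u

namespace ArchFrd

namespace UnitStab

section Thm36v

variable {D : Type u} [Category.{v} D] (π : D ⥤ D0)

/-! ### Real objects: `O^×(X) = {±1}` -/

/-- For a REAL object `X` of `C`, every element of `O^×(X)` is `id` or `((id, 1, -1), id)`.
[cite: MochizukiFrdII2008, Thm 3.6 (v) p.37] -/
theorem eq_one_or_eq_negAutOver_of_isReal (X : C π) (hX : (π.obj X.snd).IsReal) (u : Aut X)
    (hu : u ∈ PreFrobenioid.unitsSubgroup (C.toElem π) X) :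
    u = 1 ∨ u = negAutOver π X (C0.isNaivelyIsotropic_of_isRealObj
      (D0.isReal_of_hom_real X.iso.inv hX)) := by
  have hreal : X.fst.base = .real := D0.isReal_of_hom_real X.iso.inv hX
  have hmem : C0.scalar u.hom.fst ∈ D0.scalars .real := hreal ▸ u.hom.fst.scalar_mem
  rcases eq_one_or_eq_neg_one_of_mem_scalars_real hmem (norm_scalar_eq_one π X u hu) with h | h
  · exact Or.inl (eq_of_scalar_eq π X u 1 hu (one_mem _) (by rw [h]; rfl))
  · exact Or.inr (eq_of_scalar_eq π X u _ hu (negAutOver_mem π X _) (by rw [h]; rfl))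

/-- **[FrdII] Thm 3.6 (v), real objects** (p. 37): `O^×(X)` has exactly two elements for `X` real
(`Λ = ℤ`). [cite: MochizukiFrdII2008, Thm 3.6 (v) p.37] -/
theorem card_unitsSubgroup_of_isReal (X : C π) (hX : (π.obj X.snd).IsReal) :
    Nat.card (PreFrobenioid.unitsSubgroup (C.toElem π) X) = 2 := by
  have hXi : X.fst.IsNaivelyIsotropic :=
    C0.isNaivelyIsotropic_of_isRealObj (D0.isReal_of_hom_real X.iso.inv hX)
  rw [Nat.card_eq_two_iff]
  refine ⟨1, negUnit π X hXi, fun h => negUnit_ne_one π X hXi h.symm, ?_⟩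
  refine eq_univ_of_forall fun u => ?_
  rcases eq_one_or_eq_negAutOver_of_isReal π X hX u u.2 with h | h
  · exact Or.inl (Subtype.ext h)
  · exact Or.inr (Subtype.ext h)

/-! ### Complex isotropic objects: infinitely many torsion units (via `O^×(X) ≅ S¹`) -/

/-- `S¹` has infinitely many torsion elements (the roots of unity `exp(2πi/n)`, of order `n`).
[cite: MochizukiFrdII2008, Thm 3.6 (v) p.37] -/
theorem circle_torsion_infinite : {z : Circle | IsOfFinOrder z}.Infinite := by
  haveI : Fact (0 < 2 * Real.pi) := ⟨Real.two_pi_pos⟩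
  let f : ℕ → Circle := fun n => AddCircle.toCircle (((2 * Real.pi / (n + 1 : ℕ) : ℝ) : AddCircle (2 * Real.pi)))
  have hord : ∀ n : ℕ, addOrderOf (((2 * Real.pi / (n + 1 : ℕ) : ℝ) : AddCircle (2 * Real.pi))) = n + 1 :=
    fun n => AddCircle.addOrderOf_period_div (Nat.succ_pos n)
  have hpow : ∀ (x : AddCircle (2 * Real.pi)) (k : ℕ), AddCircle.toCircle x ^ k = AddCircle.toCircle (k • x) := by
    intro x k
    induction k with
    | zero => rw [pow_zero, zero_smul, AddCircle.toCircle_zero]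
    | succ k ih => rw [pow_succ, ih, succ_nsmul, AddCircle.toCircle_add]
  have hfin : ∀ n, IsOfFinOrder (f n) := by
    intro n
    rw [isOfFinOrder_iff_pow_eq_one]
    refine ⟨n + 1, Nat.succ_pos n, ?_⟩
    have h0 := addOrderOf_nsmul_eq_zero (((2 * Real.pi / (n + 1 : ℕ) : ℝ) : AddCircle (2 * Real.pi)))
    rw [hord n] at h0
    change AddCircle.toCircle _ ^ (n + 1) = 1
    rw [hpow, h0, AddCircle.toCircle_zero]
  have hinj : Function.Injective f := by
    intro n m h
    have h' := AddCircle.injective_toCircle Real.two_pi_pos.ne' h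
    have := congrArg addOrderOf h'
    rw [hord, hord] at this
    exact Nat.succ_injective this
  exact (Set.infinite_range_of_injective hinj).mono (by rintro _ ⟨n, rfl⟩; exact hfin n)

/-- For a COMPLEX naively isotropic `X ∈ Ob(C)`, `O^×(X) (≅ S¹)` has infinitely many torsion
elements. [cite: MochizukiFrdII2008, Thm 3.6 (v) p.37] -/
theorem torsion_infinite_of_isComplex (X : C π) (hX : X.fst.IsNaivelyIsotropic)
    (hc : X.fst.IsComplexObj) :
    {u : PreFrobenioid.unitsSubgroup (C.toElem π) X | IsOfFinOrder u}.Infinite := by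
  let e := circleEquivUnits π X hX hc
  refine (circle_torsion_infinite.image e.injective.injOn).mono ?_
  rintro _ ⟨z, hz, rfl⟩
  exact e.toMonoidHom.isOfFinOrder hz

/-- … so `O^×(X)` is infinite and `Nat.card O^×(X) = 0`. [cite: MochizukiFrdII2008, Thm 3.6 (v) p.37] -/
theorem infinite_unitsSubgroup_of_isComplex (X : C π) (hX : X.fst.IsNaivelyIsotropic)
    (hc : X.fst.IsComplexObj) : Infinite (PreFrobenioid.unitsSubgroup (C.toElem π) X) :=
  Set.infinite_univ_iff.mp ((torsion_infinite_of_isComplex π X hX hc).mono (subset_univ _))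

/-! ### Theorem 3.6 (v) for `C = C^ℤ` over any base: the five clauses -/

/-- The base of `X ∈ Ob(C)` in `D₀` is complex iff `X` is a complex object for `π ⋙ (D₀ → ArchBase)`;
read on the `C₀`-component. [cite: MochizukiFrdII2008, Def 3.1 (v) p.24] -/
theorem isComplexObj_fst_of (X : C π) (h : (π.obj X.snd).IsComplex) : X.fst.IsComplexObj :=
  D0.isComplex_of_hom X.iso.hom h

/-- If the base of `X` is not complex it is real. [cite: MochizukiFrdII2008, Def 3.1 (v) p.24] -/
theorem isReal_of_not_isComplex (X : C π) (h : ¬ (π.obj X.snd).IsComplex) : (π.obj X.snd).IsReal :=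
  (D0.isReal_or_isComplex _).resolve_right h

/-- A real `X` is not complex. [cite: MochizukiFrdII2008, Def 3.1 (v) p.24] -/
theorem not_isComplex_of_isReal (X : C π) (h : (π.obj X.snd).IsReal) : ¬ (π.obj X.snd).IsComplex := by
  unfold D0.IsReal at h
  unfold D0.IsComplex
  rw [h]
  exact fun h' => D0.noConfusion h'

/-- **Theorem 3.6 (v), "`O^×(A)` trivial iff (a)/(b)/(c)", for `C = C^ℤ`** over any base
`π : D → D₀` (PROVED; at `Λ = ℤ` only (a) "`A` complex non-isotropic" can hold).
[cite: MochizukiFrdII2008, Thm 3.6 (v) p.37] -/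
theorem thm36v_trivial_C : Thm36v_trivial (π ⋙ D0.toArchBase) (C.toElem π) MonoidType.Z := by
  intro X
  constructor
  · intro hbot
    refine Or.inl ⟨rfl, ?_, ?_⟩
    · by_contra hXc
      have hr := isReal_of_not_isComplex π X (fun h => hXc ((D0.isComplex_toArchBase_iff _).mpr h))
      have h2 := card_unitsSubgroup_of_isReal π X hr
      rw [hbot, Subgroup.card_bot] at h2
      exact absurd h2 (by decide)
    · intro hXi
      have hX := (Ex33ii_isotropic_iff_holds π X).mp hXi
      obtain ⟨u, -, hu⟩ := exists_torsion_ne_one π X hX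
      exact hu (Subtype.ext ((Subgroup.eq_bot_iff_forall _).mp hbot u.1 u.2))
  · rintro (⟨-, -, hXi⟩ | ⟨h, -⟩ | h)
    · exact unitsSubgroup_eq_bot_of_not_isNaivelyIsotropic π X
        (fun hX => hXi ((Ex33ii_isotropic_iff_holds π X).mpr hX))
    · cases h
    · cases h

/-- **Theorem 3.6 (v), "`O^×(A)` of order two iff `Λ = ℤ` and `A` real", for `C = C^ℤ`** over any
base (PROVED). [cite: MochizukiFrdII2008, Thm 3.6 (v) p.37] -/
theorem thm36v_orderTwo_C : Thm36v_orderTwo (π ⋙ D0.toArchBase) (C.toElem π) MonoidType.Z := by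
  intro X
  constructor
  · intro h2
    refine ⟨rfl, (D0.isReal_toArchBase_iff _).mpr (isReal_of_not_isComplex π X fun hc => ?_)⟩
    by_cases hX : X.fst.IsNaivelyIsotropic
    · haveI := infinite_unitsSubgroup_of_isComplex π X hX (isComplexObj_fst_of π X hc)
      rw [Nat.card_eq_zero_of_infinite] at h2
      exact absurd h2 (by decide)
    · rw [unitsSubgroup_eq_bot_of_not_isNaivelyIsotropic π X hX, Subgroup.card_bot] at h2
      exact absurd h2 (by decide)
  · rintro ⟨-, hr⟩
    exact card_unitsSubgroup_of_isReal π X ((D0.isReal_toArchBase_iff _).mp hr)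

/-- **Theorem 3.6 (v), "`O^×(A)` has infinitely many torsion elements iff `Λ = ℤ` and `A` complex
isotropic", for `C = C^ℤ`** over any base (PROVED). [cite: MochizukiFrdII2008, Thm 3.6 (v) p.37] -/
theorem thm36v_torsion_C : Thm36v_torsion (π ⋙ D0.toArchBase) (C.toElem π) MonoidType.Z := by
  intro X
  constructor
  · intro hinf
    have hX : X.fst.IsNaivelyIsotropic := by
      by_contra hX
      rw [unitsSubgroup_eq_bot_of_not_isNaivelyIsotropic π X hX] at hinf
      exact hinf (Set.toFinite _)
    have hc : (π.obj X.snd).IsComplex := by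
      by_contra hc
      have h2 := card_unitsSubgroup_of_isReal π X (isReal_of_not_isComplex π X hc)
      haveI := Nat.finite_of_card_ne_zero (by rw [h2]; decide)
      exact hinf (Set.toFinite _)
    exact ⟨rfl, (D0.isComplex_toArchBase_iff _).mpr hc, (Ex33ii_isotropic_iff_holds π X).mpr hX⟩
  · rintro ⟨-, hc, hXi⟩
    exact torsion_infinite_of_isComplex π X ((Ex33ii_isotropic_iff_holds π X).mp hXi)
      (isComplexObj_fst_of π X ((D0.isComplex_toArchBase_iff _).mp hc))

/-- **Theorem 3.6 (v), "`O^×(A)` nontrivial and torsion-free iff `Λ = ℚ` and `A` complex", for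
`C = C^ℤ`** over any base (PROVED: at `Λ = ℤ` both sides fail — a nontrivial `O^×(A)` contains the
involution `((id, 1, -1), id)`). [cite: MochizukiFrdII2008, Thm 3.6 (v) p.37] -/
theorem thm36v_torsionFree_C : Thm36v_torsionFree (π ⋙ D0.toArchBase) (C.toElem π) MonoidType.Z := by
  intro X
  constructor
  · rintro ⟨hne, htf⟩
    exfalso
    by_cases hX : X.fst.IsNaivelyIsotropic
    · obtain ⟨u, hu, hu1⟩ := exists_torsion_ne_one π X hX
      exact hu1 (htf u hu)
    · exact hne (unitsSubgroup_eq_bot_of_not_isNaivelyIsotropic π X hX)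
  · rintro ⟨h, -⟩
    cases h

/-- **Theorem 3.6 (v), bracket "`O^×(A) ≅ S¹ ⊗_ℤ ℚ` for `Λ = ℚ`, `A` complex", for `C = C^ℤ`**:
vacuous at `Λ = ℤ` (PROVED). [cite: MochizukiFrdII2008, Thm 3.6 (v) p.37] -/
theorem thm36v_isoCircleTensorRat_C :
    Thm36v_isoCircleTensorRat (π ⋙ D0.toArchBase) (C.toElem π) MonoidType.Z := by
  intro h
  cases h

end Thm36v

end UnitStab

end ArchFrd

end Literature.AlgebraicGeometry.Frobenioids
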